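import Literature.MathematicalPhysics.KineticTheory.KickMatchedHardSphereGas
import Literature.Analysis.FluidPDE.HardSphereFlowRestart
import HarnessLib

/-!
# Restart and time-shift identities of noise-driven hard-sphere flows; path bookkeeping of the kick swap

Topic `Literature/MathematicalPhysics/KineticTheory`. Deterministic identities behind the chronological one-kick
(Stein–Lindeberg) swap for the kick-matched hard-sphere gas `Z*` of `KickMatchedHardSphereGas` (crux line
`stein-lindeberg-kick-swap` of `InformationPercolationEngine.PercolationClosesChaos`, stmt-AtomisticToContinuum-13914,
stub S3a `SwapIdentity`), valid for ANY `Driven` rule: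

* `Driven.instant_succ_eq_freeExitTime_add`, `Driven.instant_one`, `Driven.flow_eq_freeFlight_of_lt_instant_one`,
  `Driven.count_restart`, `Driven.flow_restart` — the RESTART IDENTITY of a noise-driven hard-sphere flow at its first
  collision, at the level of paths: `Λ_t(z; ξ₀, ξ₁, …) = Λ_{t − t₁}(z₁; ξ₁, ξ₂, …)` for `t ≥ t₁` whenever the instants do
  not accumulate before `t` (before `t₁` the path is the free flight) — the strong Markov step of the swap
  (CIP 1994 App. 4.A: the special-flow representation of the collision recursion);
* `Driven.step_freeFlight`, `Driven.flow_freeFlight` — the TIME SHIFT along a free flight,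
  `Λ_t(S_δ z; ξ) = Λ_{t+δ}(z; ξ)` for `0 ≤ δ < τ(z)`, `t ≥ 0`, unconditional in accumulation;
* `KickMatchedHardSphereGas.telescope_of_succ_eq` — the telescoping algebra of the swap sum;
* `KickMatchedHardSphereGas.kickAt_inv_smul_sepVec`, `isAdmissible_inv_smul_sepVec`, `kickAt_trueKick_preAt` — the true
  impact vector of an incoming contact pair is an admissible kick and kicking with it is the elastic collision;
* `KickMatchedHardSphereGas.defect_congr`, `swapValue_eq_of_eqOn`, `swapValue_congr` — the cross-ratio defect reads the
  path on `[0, τ]` only.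

References: C. Cercignani, R. Illner, M. Pulvirenti, *The Mathematical Theory of Dilute Gases* (1994), App. 4.A
[CIP1994]; S. Chatterjee, *A generalization of the Lindeberg principle*, Ann. Probab. 34 (2006) [Chatterjee2006].
-/

noncomputable section

open scoped BigOperators ENNReal Topology RealInnerProductSpace
open MeasureTheory Set Filter
open Literature.Analysis.FluidPDE

/-! ## Restart of a driven hard-sphere flow at its first collision -/

namespace Literature.MathematicalPhysics.KineticTheory.Driven

variable {d : Type*} [Fintype d] {X : Type*} {N : ℕ} {Ξ : Type*}
variable {G : Geometry d X} {ε : ℝ} {R : Fin N → Fin N → Config N d X → Ξ → Config N d X}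

/-- **Instants restart at the first collision**: `t_{k+1}(z; ξ) = τ(z) + t_k(step ξ₀ z; ξ₁, ξ₂, …)`. [folklore] -/
theorem instant_succ_eq_freeExitTime_add (ξs : ℕ → Ξ) (z : Config N d X) (k : ℕ) :
    instant G ε R ξs z (k + 1) =
      Alexander.freeExitTime G ε z + instant G ε R (fun m => ξs (m + 1)) (step G ε R (ξs 0) z) k := by
  induction k with
  | zero => simp [instant_succ]
  | succ k ih =>
    rw [instant_succ, ih, instant_succ, stateAfter_succ', add_assoc]

/-- `t_1 = τ(z)`. [folklore] -/
theorem instant_one (ξs : ℕ → Ξ) (z : Config N d X) : instant G ε R ξs z 1 = Alexander.freeExitTime G ε z := by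
  rw [instant_succ_eq_freeExitTime_add, instant_zero, add_zero]

/-- **Before the first collision the driven flow is the free flight**: `Λ_t z = S_t z` for `t < t_1`. [folklore] -/
theorem flow_eq_freeFlight_of_lt_instant_one {ξs : ℕ → Ξ} {z : Config N d X} {t : ℝ}
    (ht : ENNReal.ofReal t < instant G ε R ξs z 1) : flow G ε R ξs z t = freeFlight G t z := by
  have hS : {k : ℕ | instant G ε R ξs z k ≤ ENNReal.ofReal t} = {0} := by
    ext k
    simp only [mem_setOf_eq, mem_singleton_iff]
    refine ⟨fun hk => ?_, fun hk => by simp [hk]⟩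
    by_contra hne
    have h1 : instant G ε R ξs z 1 ≤ instant G ε R ξs z k := monotone_instant ξs z (Nat.one_le_iff_ne_zero.2 hne)
    exact (lt_irrefl _) ((h1.trans hk).trans_lt ht)
  have hc : count G ε R ξs z t = 0 := by
    rw [count, hS, csSup_singleton]
  rw [flow, hc, instant_zero, ENNReal.toReal_zero, sub_zero, stateAfter_zero]

/-- **The number of collisions restarts at the first collision**: for `t ≥ t_1` and non-accumulating instants,
`n(t; z, ξ) = n(t − t_1; z_1, ξ_{·+1}) + 1`. [folklore] -/
theorem count_restart {ξs : ℕ → Ξ} {z : Config N d X} {t : ℝ}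
    (ht : instant G ε R ξs z 1 ≤ ENNReal.ofReal t) (hacc : ∃ K, ENNReal.ofReal t < instant G ε R ξs z K) :
    count G ε R ξs z t =
      count G ε R (fun m => ξs (m + 1)) (stateAfter G ε R ξs z 1) (t - (instant G ε R ξs z 1).toReal) + 1 := by
  set z₁ := stateAfter G ε R ξs z 1 with hz₁
  set ξs' : ℕ → Ξ := fun m => ξs (m + 1) with hξs'
  set i₁ := instant G ε R ξs z 1 with hi₁
  have hi₁_ne : i₁ ≠ ∞ := ne_top_of_le_ne_top ENNReal.ofReal_ne_top ht
  have hi₁_eq : i₁ = Alexander.freeExitTime G ε z := instant_one ξs z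
  have hsub : ENNReal.ofReal (t - i₁.toReal) = ENNReal.ofReal t - i₁ := by
    rw [ENNReal.ofReal_sub _ ENNReal.toReal_nonneg, ENNReal.ofReal_toReal hi₁_ne]
  -- membership transfer between the two index sets
  have hmem : ∀ k, instant G ε R ξs z (k + 1) ≤ ENNReal.ofReal t ↔
      instant G ε R ξs' z₁ k ≤ ENNReal.ofReal (t - i₁.toReal) := by
    intro k
    rw [instant_succ_eq_freeExitTime_add, ← hi₁_eq, hsub]
    exact ((ENNReal.cancel_of_ne hi₁_ne).le_tsub_iff_left ht).symm
  -- the restarted index set is nonempty and bounded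
  set S' : Set ℕ := {k | instant G ε R ξs' z₁ k ≤ ENNReal.ofReal (t - i₁.toReal)} with hS'
  have hS'0 : (0 : ℕ) ∈ S' := by simp [hS']
  obtain ⟨K, hK⟩ := hacc
  have hKpos : K ≠ 0 := by
    rintro rfl
    simp at hK
  obtain ⟨K', rfl⟩ := Nat.exists_eq_succ_of_ne_zero hKpos
  have hbdd : BddAbove S' := by
    refine ⟨K', fun k hk => ?_⟩
    by_contra hlt
    have hle : instant G ε R ξs' z₁ K' ≤ instant G ε R ξs' z₁ k := monotone_instant ξs' z₁ (not_le.1 hlt).le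
    have hk' : instant G ε R ξs z (k + 1) ≤ ENNReal.ofReal t := (hmem k).2 hk
    have hK'' : instant G ε R ξs z (K' + 1) ≤ ENNReal.ofReal t := by
      rw [instant_succ_eq_freeExitTime_add] at hk' ⊢
      exact (add_le_add le_rfl hle).trans hk'
    exact (lt_irrefl _) (hK''.trans_lt hK)
  have hmemS' : sSup S' ∈ S' := Nat.sSup_mem ⟨0, hS'0⟩ hbdd
  -- the original index set has greatest element `sSup S' + 1`
  have hgreat : IsGreatest {k : ℕ | instant G ε R ξs z k ≤ ENNReal.ofReal t} (sSup S' + 1) := by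
    refine ⟨(hmem _).2 hmemS', fun k hk => ?_⟩
    rcases Nat.eq_zero_or_eq_succ_pred k with h0 | hsucc
    · rw [h0]; exact Nat.zero_le _
    · rw [hsucc] at hk ⊢
      exact Nat.succ_le_succ (le_csSup hbdd ((hmem _).1 hk))
  rw [count, hgreat.csSup_eq, count]

/-- **Restart identity of the driven flow at its first collision** (the strong Markov step of the Stein–Lindeberg
swap, at the level of paths): for `t ≥ t_1` and instants that do not accumulate up to `t`,
`Λ_t(z; ξ₀, ξ₁, …) = Λ_{t − t_1}(z_1; ξ₁, ξ₂, …)` with `z_1 = step ξ₀ z`. [folklore] -/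
theorem flow_restart {ξs : ℕ → Ξ} {z : Config N d X} {t : ℝ}
    (ht : instant G ε R ξs z 1 ≤ ENNReal.ofReal t) (hacc : ∃ K, ENNReal.ofReal t < instant G ε R ξs z K) :
    flow G ε R ξs z t =
      flow G ε R (fun m => ξs (m + 1)) (stateAfter G ε R ξs z 1) (t - (instant G ε R ξs z 1).toReal) := by
  have hi₁_ne : instant G ε R ξs z 1 ≠ ∞ := ne_top_of_le_ne_top ENNReal.ofReal_ne_top ht
  have hc := count_restart ht hacc
  set c' := count G ε R (fun m => ξs (m + 1)) (stateAfter G ε R ξs z 1) (t - (instant G ε R ξs z 1).toReal)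
    with hc'
  -- the restarted instant at `c'` is finite
  have hfin : instant G ε R (fun m => ξs (m + 1)) (stateAfter G ε R ξs z 1) c' ≠ ∞ := by
    have hmem : c' ∈ {k : ℕ | instant G ε R (fun m => ξs (m + 1)) (stateAfter G ε R ξs z 1) k ≤
        ENNReal.ofReal (t - (instant G ε R ξs z 1).toReal)} := by
      -- `c'` is the supremum of a nonempty bounded set containing it (re-derive boundedness from `hacc`)
      have h0 : (0 : ℕ) ∈ {k : ℕ | instant G ε R (fun m => ξs (m + 1)) (stateAfter G ε R ξs z 1) k ≤
          ENNReal.ofReal (t - (instant G ε R ξs z 1).toReal)} := by simp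
      by_cases hbdd : BddAbove {k : ℕ | instant G ε R (fun m => ξs (m + 1)) (stateAfter G ε R ξs z 1) k ≤
          ENNReal.ofReal (t - (instant G ε R ξs z 1).toReal)}
      · exact Nat.sSup_mem ⟨0, h0⟩ hbdd
      · rw [hc', count, Nat.sSup_of_not_bddAbove hbdd]
        exact h0
    exact ne_top_of_le_ne_top ENNReal.ofReal_ne_top hmem
  have hinst : instant G ε R ξs z (c' + 1) =
      instant G ε R ξs z 1 + instant G ε R (fun m => ξs (m + 1)) (stateAfter G ε R ξs z 1) c' := by
    rw [instant_succ_eq_freeExitTime_add, instant_one]; rfl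
  have hstate : stateAfter G ε R ξs z (c' + 1) = stateAfter G ε R (fun m => ξs (m + 1)) (stateAfter G ε R ξs z 1) c' := by
    rw [stateAfter_succ']; rfl
  rw [flow, hc, flow, hstate, hinst, ENNReal.toReal_add hi₁_ne hfin]
  congr 1
  ring


/-- **Along a free flight the driven step does not change**: `step ξ (S_δ z) = step ξ z` for `0 ≤ δ ≤ τ(z) < ∞`
(same exit configuration, `Alexander.freeFlight_freeExitTime_freeFlight`). [folklore] -/
theorem step_freeFlight {ξ : Ξ} {z : Config N d X} {δ : ℝ} (hδ : 0 ≤ δ)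
    (h : ENNReal.ofReal δ ≤ Alexander.freeExitTime G ε z) (hτ : Alexander.freeExitTime G ε z ≠ ∞) :
    step G ε R ξ (freeFlight G δ z) = step G ε R ξ z := by
  have h1 := Alexander.freeExitTime_freeFlight_add (G := G) (ε := ε) hδ h
  have hτ' : Alexander.freeExitTime G ε (freeFlight G δ z) ≠ ∞ := by
    intro htop; rw [htop, top_add] at h1; exact hτ h1.symm
  rw [step, if_neg hτ', step, if_neg hτ]
  dsimp only
  rw [Alexander.freeFlight_freeExitTime_freeFlight hδ h hτ]

/-- **Time shift of the driven flow along a free flight** (unconditional in accumulation): for `0 ≤ δ < τ(z)` and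
`t ≥ 0`, `Λ_t(S_δ z; ξ) = Λ_{t+δ}(z; ξ)` — the states after the first are the same and all instants shift by `δ`, so
the two index sets `{k | t_k ≤ t}` coincide (junk supremum included). This transports almost-sure properties of `Z*`
from a datum `Φ_s z` in the interior (rational `s`) to the next collision configuration of the orbit. [folklore] -/
theorem flow_freeFlight {ξs : ℕ → Ξ} {z : Config N d X} {δ t : ℝ} (hδ : 0 ≤ δ)
    (hlt : ENNReal.ofReal δ < Alexander.freeExitTime G ε z) (ht : 0 ≤ t) :
    flow G ε R ξs (freeFlight G δ z) t = flow G ε R ξs z (t + δ) := by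
  by_cases hτ : Alexander.freeExitTime G ε z = ∞
  · -- no collision ever: both flows are free flights
    have hτ' : Alexander.freeExitTime G ε (freeFlight G δ z) = ∞ := Alexander.freeExitTime_freeFlight_eq_top hδ hτ
    rw [flow_eq_freeFlight_of_lt_instant_one (by rw [instant_one, hτ']; exact ENNReal.ofReal_lt_top),
      flow_eq_freeFlight_of_lt_instant_one (by rw [instant_one, hτ]; exact ENNReal.ofReal_lt_top), freeFlight_add]
  -- states after the first agree, instants shift by `δ`
  have hstep : step G ε R (ξs 0) (freeFlight G δ z) = step G ε R (ξs 0) z := step_freeFlight hδ hlt.le hτ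
  have hstate : ∀ k, stateAfter G ε R ξs (freeFlight G δ z) (k + 1) = stateAfter G ε R ξs z (k + 1) := fun k => by
    rw [stateAfter_succ', stateAfter_succ', hstep]
  have hinst : ∀ k, instant G ε R ξs (freeFlight G δ z) (k + 1) + ENNReal.ofReal δ = instant G ε R ξs z (k + 1) :=
    fun k => by
    rw [instant_succ_eq_freeExitTime_add, instant_succ_eq_freeExitTime_add, hstep, add_right_comm,
      Alexander.freeExitTime_freeFlight_add hδ hlt.le]
  -- the index sets coincide
  have hS : {k : ℕ | instant G ε R ξs (freeFlight G δ z) k ≤ ENNReal.ofReal t} =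
      {k : ℕ | instant G ε R ξs z k ≤ ENNReal.ofReal (t + δ)} := by
    ext k
    simp only [mem_setOf_eq]
    rcases Nat.eq_zero_or_eq_succ_pred k with h0 | hsucc
    · rw [h0, instant_zero, instant_zero]; exact ⟨fun _ => bot_le, fun _ => bot_le⟩
    · rw [hsucc, ← hinst, ENNReal.ofReal_add ht hδ]
      exact (ENNReal.add_le_add_iff_right ENNReal.ofReal_ne_top).symm
  have hc : count G ε R ξs (freeFlight G δ z) t = count G ε R ξs z (t + δ) := by rw [count, count, hS]
  rw [flow, flow, hc]
  set c := count G ε R ξs z (t + δ) with hc_def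
  rcases Nat.eq_zero_or_eq_succ_pred c with h0 | hsucc
  · rw [h0, instant_zero, instant_zero, ENNReal.toReal_zero, sub_zero, sub_zero, stateAfter_zero, stateAfter_zero,
      freeFlight_add]
  · -- `c = k + 1`: the index set is bounded, so `t_c ≤ t + δ < ∞`
    have hbdd : BddAbove {k : ℕ | instant G ε R ξs z k ≤ ENNReal.ofReal (t + δ)} := by
      by_contra hnb
      have : c = 0 := by rw [hc_def, count, Nat.sSup_of_not_bddAbove hnb]
      omega
    have hmem : c ∈ {k : ℕ | instant G ε R ξs z k ≤ ENNReal.ofReal (t + δ)} :=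
      Nat.sSup_mem ⟨0, by simp⟩ hbdd
    have hfin : instant G ε R ξs z c ≠ ∞ := ne_top_of_le_ne_top ENNReal.ofReal_ne_top hmem
    rw [hsucc] at hfin ⊢
    have hfin' : instant G ε R ξs (freeFlight G δ z) (c.pred + 1) ≠ ∞ := by
      intro htop
      have := hinst c.pred
      rw [htop, top_add] at this
      exact hfin this.symm
    rw [hstate, ← hinst c.pred, ENNReal.toReal_add hfin' ENNReal.ofReal_ne_top, ENNReal.toReal_ofReal hδ]
    congr 1
    ring

end Literature.MathematicalPhysics.KineticTheory.Driven

namespace Literature.MathematicalPhysics.KineticTheory.KickMatchedHardSphereGas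

/-! ## The pathwise telescoping -/

/-- **Telescoping of the chronological swap**: if consecutive hybrids match, `b (m+1) = a m` for `m < M`, then
`∑_{m ≤ M} (a m − b m) = a M − b 0`. With `a m` = "true through collision `m`, `Z*` after" and `b m` =
"true before collision `m`, restricted-flux kick at `m`, `Z*` after" this is `swapSum = φ(D_true) − E φ(D_{Z*})`.
[folklore] -/
theorem telescope_of_succ_eq {a b : ℕ → ℝ} (M : ℕ) (h : ∀ m < M, b (m + 1) = a m) :
    ∑ m ∈ Finset.range (M + 1), (a m - b m) = a M - b 0 := by
  induction M with
  | zero => simp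
  | succ n ih =>
    rw [Finset.sum_range_succ, ih fun m hm => h m (by omega), h n (by omega)]
    ring

/-! ## The true kick is admissible, and kicking with it is the elastic collision -/

variable {σ : ℝ} {N : ℕ}

/-- **Kicking with the true impact vector is the elastic collision**: re-placing the partner along
`ε⁻¹ sepVec xᵢ xⱼ` puts it back where it was (`proj ∘ reprSym = proj` on the torus). [folklore] -/
-- adapted from the W2 worker's `Km.kickAt_inv_smul_sepVec` (work/stubs/stub_kickMatchedStationaryCore.lean, not landed)
theorem kickAt_inv_smul_sepVec (hε : hsDiameter σ N ≠ 0) (i j : Fin (N + 1)) (y : Cfg N) :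
    kickAt σ N i j ((hsDiameter σ N)⁻¹ • geo.sepVec (y i).1 (y j).1) y = collidePair geo i j y := by
  unfold kickAt
  congr 1
  rw [smul_smul, mul_inv_cancel₀ hε, one_smul, Torus.geometry_translate, Torus.geometry_sepVec,
    Literature.Analysis.FunctionSpaces.Torus.proj_neg, Torus.proj_reprSym, ← sub_eq_add_neg, sub_sub_cancel,
    Prod.mk.eta, Function.update_eq_self]

/-- **The true impact vector of an incoming contact pair is an admissible kick**: it is a unit vector, it lies on
the incoming hemisphere (`(w − v)·ω > 0` is `IsIncoming`), and the kicked configuration is the elastic collision of a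
configuration of the (closed) hard-sphere domain. [folklore] -/
theorem isAdmissible_inv_smul_sepVec (hε : 0 < hsDiameter σ N) {i j : Fin (N + 1)} {y : Cfg N}
    (hc : y ∈ contactSet geo (N + 1) (hsDiameter σ N) i j) (hin : IsIncoming geo y i j) :
    IsAdmissible σ N i j ((hsDiameter σ N)⁻¹ • geo.sepVec (y i).1 (y j).1) y := by
  obtain ⟨hdom, hnorm⟩ := mem_contactSet.1 hc
  refine ⟨?_, ?_, ?_⟩
  · rw [norm_smul, norm_inv, Real.norm_eq_abs, abs_of_pos hε, hnorm, inv_mul_cancel₀ hε.ne']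
  · rw [real_inner_smul_right]
    refine mul_pos (inv_pos.2 hε) ?_
    have h : ⟪geo.sepVec (y i).1 (y j).1, (y i).2 - (y j).2⟫ < 0 := hin
    rw [← neg_sub, inner_neg_left, real_inner_comm]
    linarith
  · rw [kickAt_inv_smul_sepVec hε.ne']
    exact (collidePair_mem_hardSphereDomain_iff y).2 hdom

/-- At the `k`-th collision of an orbit, if the post-collisional configuration has the pair `pairAt` in contact
with the PRE-collisional configuration incoming, then the true kick is admissible at `preAt` and kicking `preAt`
with it returns `postAt` (`collidePair` is an involution). [folklore] -/
theorem kickAt_trueKick_preAt (hε : 0 < hsDiameter σ N) (Φ : Flow σ N) (z : Cfg N) (k : ℕ)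
    (hc : preAt σ N Φ z k ∈ contactSet geo (N + 1) (hsDiameter σ N) (pairAt σ N Φ z k).1 (pairAt σ N Φ z k).2)
    (hin : IsIncoming geo (preAt σ N Φ z k) (pairAt σ N Φ z k).1 (pairAt σ N Φ z k).2)
    (hij : (pairAt σ N Φ z k).1 ≠ (pairAt σ N Φ z k).2) :
    IsAdmissible σ N (pairAt σ N Φ z k).1 (pairAt σ N Φ z k).2 (trueKick σ N Φ z k) (preAt σ N Φ z k) ∧
      kickAt σ N (pairAt σ N Φ z k).1 (pairAt σ N Φ z k).2 (trueKick σ N Φ z k) (preAt σ N Φ z k) =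
        postAt σ N Φ z k := by
  -- the true kick read on `postAt` equals the one read on `preAt` (positions are unchanged by `collidePair`)
  have hpos : ∀ l, (preAt σ N Φ z k l).1 = (postAt σ N Φ z k l).1 := fun l => by
    unfold preAt
    exact collidePair_apply_fst _ _
  have htk : trueKick σ N Φ z k =
      (hsDiameter σ N)⁻¹ • geo.sepVec ((preAt σ N Φ z k) (pairAt σ N Φ z k).1).1
        ((preAt σ N Φ z k) (pairAt σ N Φ z k).2).1 := by
    unfold trueKick
    rw [hpos, hpos]
  rw [htk]
  refine ⟨isAdmissible_inv_smul_sepVec hε hc hin, ?_⟩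
  rw [kickAt_inv_smul_sepVec hε.ne']
  unfold preAt
  exact collidePair_collidePair hij _


/-! ## The defect reads the path on `[0, τ]` only -/

/-- **The defect reads the path on `[0, τ]` only**: two paths that agree on `Icc 0 τ` have the same cross-ratio
defect (collision times in `[0, τ]`, the marks at them and the mollified pair fields `∫_{[0,τ]} …` are all read off
`γ|[0,τ]`). This is what makes the last hybrid equal to `φ_η(D_true)` (after the last collision in `(0, τ]` the `Z*`
continuation is the orbit's free flight up to `τ`) and what lets every hybrid comparison ignore negative times.
[folklore] -/
theorem defect_congr {τ : ℝ} {χ : ℝ × T3 → ℝ} {Ψ : V3 × V3 × V3 → ℝ} {r : ℝ} {γ γ' : ℝ → Cfg N}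
    (h : EqOn γ γ' (Icc 0 τ)) : defect σ N τ χ Ψ r γ = defect σ N τ χ Ψ r γ' := by
  have hC : collisionTimes (Torus.geometry (Fin 3)) (hsDiameter σ N) γ ∩ Icc 0 τ =
      collisionTimes (Torus.geometry (Fin 3)) (hsDiameter σ N) γ' ∩ Icc 0 τ := by
    ext s
    simp only [mem_inter_iff, mem_collisionTimes]
    constructor
    · rintro ⟨hs, hI⟩; rw [h hI] at hs; exact ⟨hs, hI⟩
    · rintro ⟨hs, hI⟩; rw [← h hI] at hs; exact ⟨hs, hI⟩
  unfold defect
  dsimp only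
  rw [hC]
  congr 1
  all_goals
    congr 1
    refine finsum_congr fun s => finsum_congr fun hs => Finset.sum_congr rfl fun i _ =>
      Finset.sum_congr rfl fun j _ => ?_
    rw [h hs.2]
    split_ifs
    · congr 1
      exact setIntegral_congr_fun measurableSet_Icc fun s₁ hs₁ => by rw [h hs₁]
    · rfl

/-- **The last hybrid is the true statistic**: if for every dice sequence the continuation path of the `k`-th swap
with kick `ω` agrees with the orbit on `[0, τ]`, then `swapValue … k ω = φ_η(D_true z)` (`kmDice` is a probability
law). [folklore] -/
theorem swapValue_eq_of_eqOn (Φ : Flow σ N) {τ : ℝ} (χ : ℝ × T3 → ℝ) (Ψ : V3 × V3 × V3 → ℝ) (r η : ℝ) {z : Cfg N}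
    {k : ℕ} {ω : V3} (h : ∀ u, EqOn (contPath σ N Φ z k ω u) (fun s => Φ.flow s z) (Icc 0 τ)) :
    swapValue σ N Φ τ χ Ψ r η z k ω = phiEta η (trueDefect σ N Φ τ χ Ψ r z) := by
  have hd : ∀ u, defect σ N τ χ Ψ r (contPath σ N Φ z k ω u) = trueDefect σ N Φ τ χ Ψ r z := fun u =>
    defect_congr (h u)
  unfold swapValue
  simp only [hd]
  rw [integral_const, probReal_univ, one_smul]

/-- **Two swaps with the same continuation have the same value**: if the continuation paths of `(k, ω)` and
`(k', ω')` agree on `[0, τ]` for every dice sequence, their `swapValue`s agree. [folklore] -/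
theorem swapValue_congr (Φ : Flow σ N) {τ : ℝ} (χ : ℝ × T3 → ℝ) (Ψ : V3 × V3 × V3 → ℝ) (r η : ℝ) {z : Cfg N}
    {k k' : ℕ} {ω ω' : V3}
    (h : ∀ u, EqOn (contPath σ N Φ z k ω u) (contPath σ N Φ z k' ω' u) (Icc 0 τ)) :
    swapValue σ N Φ τ χ Ψ r η z k ω = swapValue σ N Φ τ χ Ψ r η z k' ω' := by
  unfold swapValue
  exact integral_congr_ae (Eventually.of_forall fun u => by
    show phiEta η (defect σ N τ χ Ψ r (contPath σ N Φ z k ω u)) = phiEta η (defect σ N τ χ Ψ r (contPath σ N Φ z k' ω' u))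
    rw [defect_congr (h u)])

end Literature.MathematicalPhysics.KineticTheory.KickMatchedHardSphereGas

end
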